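import Summits.CriticalPhenomena.PercolationContinuityZ3.Theorems.Transplant.GrigorchukTorsion
import Mathlib.Tactic.Group
import HarnessLib

/-!
# A CONTRACTING WEIGHTED LENGTH on the first Grigorchuk group: Bartholdi's level-one form of Grigorchuk's length-reduction lemma —
# the two sections of an element of `St_𝔊(1)` have total weighted length `≤ (13/16)·(weighted length + one letter)`

builds on p205010 (kernel theorem, internal audit signed; external expert review pending) — nothing in this file uses p205010; pure group theory / word
combinatorics, no percolation statement, no node touched.  Lane `prim-bschramm`, seat `prim-bschramm-gen-1` gen 8 (GEN pen; offer O-GR file G1, lead g25 GO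
2026-08-28T05:41Z).  DEFINITION LANE (review-queued): the letter weights `Letter.lw` / `V4.lw`, the weighted length of a word `wordLW` and of a normal form
`NForm.wlen`, and the section word `swV` of a Klein letter; everything else is theorems.  Helper file (`--supports stmt-CriticalPhenomena-4575 --as helper`).  No instance,
no notation; REUSES p590723 «GrigorchukNormalForms» (`NForm`, `push`, `nf`, `blocks`, the Klein table) and p591617 «GrigorchukTorsion» (`sw`, `psw`, `sec_blocks`,
`sec_letter`) and p590401 «GrigorchukSectionsDefs» (`sec`, `sec_conj_genA`) — nothing restated.  NOTHING about growth is CLAIMED in this file (that is G3); nothing about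
amenability, `θ(p_c)`, or any `@[conjecture]`.

THE WEIGHTS.  `lw(a) = 3000`, `lw(b) = 3400`, `lw(c) = 2200`, `lw(d) = 1225`, ratio `η = 13/16`.  They satisfy EXACTLY
`lw a + lw c = η (lw a + lw b)` (`5200 = 13·6400/16`), `lw a + lw d = η (lw a + lw c)` (`4225 = 13·5200/16`), `lw b ≤ η (lw a + lw d)` (`3400 ≤ 3432`), and the KLEIN
TRIANGLE inequalities `lw b ≤ lw c + lw d` (`3400 ≤ 3425`), `lw c ≤ lw b + lw d`, `lw d ≤ lw b + lw c` — so (§1) the Klein rewriting `push`/`nf` of p590723 never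
increases the weighted length, and (§3) under the sections `b ↦ (a | c)`, `c ↦ (a | d)`, `d ↦ (1 | b)` a block `x·a` of weight `lw x + 3000` produces section letters of
total weight `≤ η·(lw x + 3000)`.
* §1 `Letter.lw`, `V4.lw`, `wordLW`, `NForm.wlen` (= `Σ_blocks (lw x + 3000) + [3000 if leading a] + lw q`); `V4.lw_mul_le`; **`wlen_push_le`**, **`wlen_nf_le`**
  (`(nf w).wlen ≤ wordLW w`), `length_le_wlen` (`4225·|L| ≤ wlen`).
* §2 letter-`0` parity: `blocks_apply_zero`, `eval_apply_zero`, so `N.eval ∈ St(1)` iff the number of `a`'s is even (`even_of_eval_mem_stabOne`).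
* §3 `swV s q` (section word of a final Klein letter), the per-letter bound `lw_sw_add` and **`lw_psw_add`**:
  `16·(wordLW (psw s L) + wordLW (psw ¬s L)) ≤ 13·Σ (lw xᵢ + 3000)`.
* §4 **`exists_secWords (N) (hN : N.eval ∈ stabOne)`: words `w₀, w₁` with `φ₀(N.eval) = Π w₀`, `φ₁(N.eval) = Π w₁` and
  `16·(wordLW w₀ + wordLW w₁) ≤ 13·(N.wlen + 3000)`** — the level-one weighted contraction (the `+3000` is the final Klein letter, which carries no `a` of its own).
[cite: Grigorchuk1984, Lemma on length reduction through the sections (degrees of growth of finitely generated groups)] [cite: Bartholdi1998, Prop. (the weighted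
metric with η ≈ 0.811 contracting at level one)] [cite: Grigorchuk1980, relations b = (a,c), c = (a,d), d = (1,b)]
-/

noncomputable section

namespace Summit.CriticalPhenomena.PercolationContinuityZ3.Theorems.Transplant

namespace Grigorchuk

open scoped Classical

/-! ## §1 The weights and the weighted length; `push` and `nf` do not increase it -/

/-- **The weight of a letter**: `a ↦ 3000`, `b ↦ 3400`, `c ↦ 2200`, `d ↦ 1225` (a rational rescaling of Bartholdi's weights; ratio `η = 13/16`).
[cite: Bartholdi1998, Prop. (the weighted metric)] -/
def Letter.lw : Letter → ℕ
  | .a => 3000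
  | .x .b => 3400
  | .x .c => 2200
  | .x .d => 1225

/-- The weight of a Klein letter (`1 ↦ 0`). [cite: Bartholdi1998, Prop. (the weighted metric)] -/
def V4.lw : V4 → ℕ
  | .e => 0
  | .b => 3400
  | .c => 2200
  | .d => 1225

/-- The weighted length of a word. [cite: Bartholdi1998, Prop. (the weighted metric)] -/
def wordLW (w : List Letter) : ℕ := (w.map Letter.lw).sum

/-- **The weighted length of a normal form** `[a]^p (x₁ a)⋯(x_k a) q`: `3000·p + Σ (lw xᵢ + 3000) + lw q`. [cite: Bartholdi1998, Prop. (the weighted metric)] -/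
def NForm.wlen (N : NForm) : ℕ := (if N.p then 3000 else 0) + (N.L.map fun x => x.toV4.lw + 3000).sum + N.q.lw

/-- `wordLW` is additive. [folklore] -/
theorem wordLW_append (u v : List Letter) : wordLW (u ++ v) = wordLW u + wordLW v := by
  simp [wordLW, List.map_append, List.sum_append]

/-- `wordLW (ℓ :: w) = lw ℓ + wordLW w`. [folklore] -/
@[simp] theorem wordLW_cons (ℓ : Letter) (w : List Letter) : wordLW (ℓ :: w) = ℓ.lw + wordLW w := by
  simp [wordLW]

/-- `wordLW [] = 0`. [folklore] -/
@[simp] theorem wordLW_nil : wordLW [] = 0 := rfl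

/-- The weight of a Klein letter as a letter. [folklore] -/
theorem BCD.lw_toV4 (v : BCD) : v.toV4.lw = (Letter.x v).lw := by cases v <;> rfl

/-- **The Klein triangle inequalities**: `lw (u v) ≤ lw u + lw v` (`3400 ≤ 2200 + 1225`, …). [cite: Bartholdi1998, Prop. (the weighted metric)] -/
theorem V4.lw_mul_le (u v : V4) : (V4.mul u v).lw ≤ u.lw + v.lw := by
  cases u <;> cases v <;> decide

/-- `wlen 1 = 0`. [folklore] -/
@[simp] theorem NForm.wlen_one : NForm.one.wlen = 0 := by simp [NForm.one, NForm.wlen, V4.lw]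

/-- **`wlen (push ℓ N) ≤ wlen N + lw ℓ`**: the Klein rewriting never increases the weighted length. [cite: Bartholdi1998, Prop. (the weighted metric)] -/
theorem wlen_push_le (ℓ : Letter) (N : NForm) : (push ℓ N).wlen ≤ N.wlen + ℓ.lw := by
  rcases ℓ with _ | v
  · rcases N with ⟨p, L, q⟩; cases p <;> simp [push, NForm.wlen, Letter.lw] <;> omega
  · rcases N with ⟨p, L, q⟩
    cases p with
    | true => simp [push, NForm.wlen, BCD.lw_toV4]; omega
    | false =>
      cases L with
      | nil =>
        simp only [push, NForm.wlen, List.map_nil, List.sum_nil]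
        have h := V4.lw_mul_le v.toV4 q
        rw [BCD.lw_toV4] at h
        simp; omega
      | cons x₁ L =>
        have hm := V4.lw_mul_le v.toV4 x₁.toV4
        rw [BCD.lw_toV4 v] at hm
        simp only [push]
        split <;> rename_i heq <;> rw [heq] at hm <;> simp [NForm.wlen, BCD.toV4, V4.lw] at hm ⊢ <;> omega

/-- **`wlen (nf w) ≤ wordLW w`.** [cite: Bartholdi1998, Prop. (the weighted metric)] -/
theorem wlen_nf_le (w : List Letter) : (nf w).wlen ≤ wordLW w := by
  induction w with
  | nil => simp
  | cons ℓ w ih => rw [nf_cons, wordLW_cons]; exact (wlen_push_le ℓ _).trans (by omega)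

/-- Each block weighs at least `4225`: `4225·|L| ≤ wlen`. [folklore] -/
theorem length_le_wlen (N : NForm) : 4225 * N.L.length ≤ N.wlen := by
  rcases N with ⟨p, L, q⟩
  have h : ∀ L : List BCD, 4225 * L.length ≤ (L.map fun x => x.toV4.lw + 3000).sum := by
    intro L; induction L with
    | nil => simp
    | cons x L ih =>
      have hx : 1225 ≤ x.toV4.lw := by cases x <;> decide
      simp only [List.length_cons, List.map_cons, List.sum_cons]; omega
  have := h L
  simp only [NForm.wlen]; omega

/-! ## §2 The action on the first letter: `N.eval ∈ St(1)` iff the number of `a`'s is even -/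

/-- A Klein letter preserves the first letter. [cite: BartholdiErschler2012, §3.1] -/
theorem V4.toPerm_apply_zero (q : V4) (x : Ray) : q.toPerm x 0 = x 0 := by
  rcases q with _ | _ | _ | _
  · rfl
  · exact mem_stabOne.1 genB_mem_stabOne x
  · exact mem_stabOne.1 genC_mem_stabOne x
  · exact mem_stabOne.1 genD_mem_stabOne x

/-- **`blocks L` flips the first letter `|L|` times.** [cite: BartholdiErschler2012, §3.1 (St(1) = even number of a's)] -/
theorem blocks_apply_zero (L : List BCD) (x : Ray) : blocks L x 0 = (if L.length % 2 = 0 then x 0 else !x 0) := by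
  induction L generalizing x with
  | nil => simp
  | cons y L ih =>
    rw [blocks_cons, Equiv.Perm.mul_apply, Equiv.Perm.mul_apply]
    have h1 : y.toPerm (genA (blocks L x)) 0 = genA (blocks L x) 0 := mem_stabOne.1 (BCD.toPerm_mem_stabOne y) _
    rw [h1, genA_apply_zero, ih, List.length_cons]
    have h2 : (L.length + 1) % 2 = 0 ↔ ¬ L.length % 2 = 0 := by omega
    by_cases h : L.length % 2 = 0 <;> simp [h, h2]

/-- The number of `a`'s of a normal form. [cite: Grigorchuk1980, reduced words] -/
theorem eval_apply_zero (N : NForm) (x : Ray) :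
    N.eval x 0 = (if ((if N.p then 1 else 0) + N.L.length) % 2 = 0 then x 0 else !x 0) := by
  rcases N with ⟨p, L, q⟩
  simp only [NForm.eval, Equiv.Perm.mul_apply]
  cases p
  · simp only [Bool.false_eq_true, ↓reduceIte, Equiv.Perm.one_apply, zero_add]
    rw [blocks_apply_zero, V4.toPerm_apply_zero]
  · simp only [↓reduceIte]
    rw [genA_apply_zero, blocks_apply_zero, V4.toPerm_apply_zero]
    have h2 : (1 + L.length) % 2 = 0 ↔ ¬ L.length % 2 = 0 := by omega
    by_cases h : L.length % 2 = 0 <;> simp [h, h2]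

/-- **`N.eval ∈ St(1)` forces an even number of `a`'s.** [cite: BartholdiErschler2012, §3.1 (St(1) = words with an even number of a's)] -/
theorem even_of_eval_mem_stabOne (N : NForm) (hN : N.eval ∈ stabOne) : ((if N.p then 1 else 0) + N.L.length) % 2 = 0 := by
  by_contra h
  have e := mem_stabOne.1 hN rho
  rw [eval_apply_zero, if_neg h] at e
  revert e; cases rho 0 <;> decide

/-! ## §3 Section words of letters and blocks: the `13/16` bound -/

/-- The section word of a final Klein letter (`1 ↦` the empty word). [cite: Grigorchuk1980, relations b = (a,c), c = (a,d), d = (1,b)] -/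
def swV (s : Bool) : V4 → List Letter
  | .e => []
  | .b => sw s .b
  | .c => sw s .c
  | .d => sw s .d

/-- A Klein letter lies in `St(1)`. [cite: BartholdiErschler2012, §3.1] -/
theorem V4.toPerm_mem_stabOne (q : V4) : q.toPerm ∈ stabOne := fun x => V4.toPerm_apply_zero q x

/-- The section of a final Klein letter is its section word. [cite: Grigorchuk1980, relations b = (a,c), c = (a,d), d = (1,b)] -/
theorem sec_V4 (s : Bool) (q : V4) : (sec s ⟨q.toPerm, V4.toPerm_mem_stabOne q⟩ : Equiv.Perm Ray) = ((swV s q).map Letter.toPerm).prod := by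
  rcases q with _ | _ | _ | _
  · have e : (⟨V4.e.toPerm, V4.toPerm_mem_stabOne V4.e⟩ : ↥stabOne) = 1 := Subtype.ext rfl
    rw [e, map_one]; rfl
  · exact sec_letter s .b _
  · exact sec_letter s .c _
  · exact sec_letter s .d _

/-- **Per-letter contraction**: `16·(lw (x)₀ + lw (x)₁) ≤ 13·(lw x + lw a)` for `x ∈ {b, c, d}` (`83200 = 83200`, `67600 = 67600`, `54400 ≤ 54925`).
[cite: Bartholdi1998, Prop. (η-contraction at level one)] -/
theorem lw_sw_add (s : Bool) (x : BCD) : 16 * (wordLW (sw s x) + wordLW (sw (!s) x)) ≤ 13 * (x.toV4.lw + 3000) := by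
  cases s <;> cases x <;> decide

/-- The same for a final Klein letter. [cite: Bartholdi1998, Prop. (η-contraction at level one)] -/
theorem lw_swV_add (s : Bool) (q : V4) : 16 * (wordLW (swV s q) + wordLW (swV (!s) q)) ≤ 13 * (q.lw + 3000) := by
  cases s <;> cases q <;> decide

/-- **Contraction over a list of blocks**: `16·(wordLW (psw s L) + wordLW (psw ¬s L)) ≤ 13·Σ (lw xᵢ + 3000)`.
[cite: Grigorchuk1984, length-reduction lemma] [cite: Bartholdi1998, Prop. (η-contraction at level one)] -/
theorem lw_psw_add (L : List BCD) : ∀ s : Bool,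
    16 * (wordLW (psw s L) + wordLW (psw (!s) L)) ≤ 13 * (L.map fun x => x.toV4.lw + 3000).sum := by
  induction L with
  | nil => intro s; cases s <;> simp
  | cons x L ih =>
    intro s
    have h1 := lw_sw_add s x
    have h2 := ih (!s)
    rw [Bool.not_not] at h2
    rw [psw_cons, psw_cons, Bool.not_not, wordLW_append, wordLW_append, List.map_cons, List.sum_cons]
    omega

/-! ## §4 The section words of a normal form in `St(1)` and the level-one weighted contraction -/

/-- Sections of a normal form `(x₁ a)⋯(x_{2k} a)·q` (no leading `a`, `|L|` even): the words `psw s L ++ swV s q`. [cite: Grigorchuk1980, sections of a word] -/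
theorem sec_eval_false (L : List BCD) (q : V4) (k : ℕ) (hL : L.length = 2 * k) (h : (⟨false, L, q⟩ : NForm).eval ∈ stabOne) (s : Bool) :
    (sec s ⟨(⟨false, L, q⟩ : NForm).eval, h⟩ : Equiv.Perm Ray) = ((psw s L ++ swV s q).map Letter.toPerm).prod := by
  have hB : blocks L ∈ stabOne := blocks_mem_stabOne k L hL
  have e : (⟨(⟨false, L, q⟩ : NForm).eval, h⟩ : ↥stabOne) = ⟨blocks L, hB⟩ * ⟨q.toPerm, V4.toPerm_mem_stabOne q⟩ :=
    Subtype.ext (by simp [NForm.eval])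
  rw [e, map_mul, sec_blocks k L hL hB s, sec_V4, prod_append_letters]

/-- Sections of a normal form `a (x₁ a)(x₂ a)⋯(x_{2k+1} a)·q = (a x₁ a)·((x₂ a)⋯ q)`: the words `sw ¬s x₁ ++ psw s L ++ swV s q`.
[cite: Grigorchuk1980, sections of a word] [cite: BartholdiErschler2012, §3.1 (ψ(a g a) swaps)] -/
theorem sec_eval_true (x₁ : BCD) (L : List BCD) (q : V4) (k : ℕ) (hL : L.length = 2 * k) (h : (⟨true, x₁ :: L, q⟩ : NForm).eval ∈ stabOne) (s : Bool) :
    (sec s ⟨(⟨true, x₁ :: L, q⟩ : NForm).eval, h⟩ : Equiv.Perm Ray) = ((sw (!s) x₁ ++ (psw s L ++ swV s q)).map Letter.toPerm).prod := by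
  have hx : x₁.toPerm ∈ stabOne := BCD.toPerm_mem_stabOne x₁
  have hc : genA * x₁.toPerm * genA ∈ stabOne := conj_genA_mem_stabOne hx
  have hrest : (⟨false, L, q⟩ : NForm).eval ∈ stabOne := by
    intro x; rw [eval_apply_zero]; simp [hL]
  have e : (⟨(⟨true, x₁ :: L, q⟩ : NForm).eval, h⟩ : ↥stabOne) = ⟨genA * x₁.toPerm * genA, hc⟩ * ⟨(⟨false, L, q⟩ : NForm).eval, hrest⟩ :=
    Subtype.ext (by simp [NForm.eval, BCD.toPerm, mul_assoc])
  rw [e, map_mul,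
    show (⟨genA * x₁.toPerm * genA, hc⟩ : ↥stabOne) = ⟨genA * ((⟨x₁.toPerm, hx⟩ : ↥stabOne) : Equiv.Perm Ray) * genA, conj_genA_mem_stabOne hx⟩ from rfl,
    sec_conj_genA, sec_letter, sec_eval_false L q k hL hrest s, prod_append_letters, prod_append_letters, prod_append_letters]

/-- **THE LEVEL-ONE WEIGHTED CONTRACTION (Grigorchuk 1984 / Bartholdi 1998).**  For every normal form `N` with `N.eval ∈ St(1)` there are words `w₀`, `w₁` in
`a, b, c, d` evaluating to the two sections `φ₀(N.eval)`, `φ₁(N.eval)` with `16·(wordLW w₀ + wordLW w₁) ≤ 13·(N.wlen + 3000)`, i.e. total weighted length at most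
`η·(‖N‖ + lw a)`, `η = 13/16`. [cite: Grigorchuk1984, length-reduction lemma] [cite: Bartholdi1998, Prop. (η-contraction at level one)] -/
theorem exists_secWords (N : NForm) (hN : N.eval ∈ stabOne) :
    ∃ w₀ w₁ : List Letter, (sec false ⟨N.eval, hN⟩ : Equiv.Perm Ray) = (w₀.map Letter.toPerm).prod ∧
      (sec true ⟨N.eval, hN⟩ : Equiv.Perm Ray) = (w₁.map Letter.toPerm).prod ∧ 16 * (wordLW w₀ + wordLW w₁) ≤ 13 * (N.wlen + 3000) := by
  have hpar := even_of_eval_mem_stabOne N hN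
  rcases N with ⟨p, L, q⟩
  cases p with
  | false =>
    -- `|L|` even
    have hL : L.length = 2 * (L.length / 2) := by simp at hpar; omega
    refine ⟨psw false L ++ swV false q, psw true L ++ swV true q, sec_eval_false L q _ hL hN false, sec_eval_false L q _ hL hN true, ?_⟩
    have h1 := lw_psw_add L false
    have h2 := lw_swV_add false q
    simp only [Bool.not_false] at h1 h2
    rw [wordLW_append, wordLW_append]
    simp only [NForm.wlen, Bool.false_eq_true, ↓reduceIte, zero_add]
    omega
  | true =>
    cases L with
    | nil => simp at hpar
    | cons x₁ L =>
      have hL : L.length = 2 * (L.length / 2) := by simp at hpar; omega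
      refine ⟨sw true x₁ ++ (psw false L ++ swV false q), sw false x₁ ++ (psw true L ++ swV true q), ?_, ?_, ?_⟩
      · simpa using sec_eval_true x₁ L q _ hL hN false
      · simpa using sec_eval_true x₁ L q _ hL hN true
      have h1 := lw_psw_add L false
      have h2 := lw_swV_add false q
      have h3 := lw_sw_add true x₁
      simp only [Bool.not_false, Bool.not_true] at h1 h2 h3
      rw [wordLW_append, wordLW_append, wordLW_append, wordLW_append]
      simp only [NForm.wlen, ↓reduceIte, List.map_cons, List.sum_cons]
      omega

/-- **Corollary (normal-form version): the sections of `N.eval ∈ St_𝔊(1)` have normal forms of total weighted length `≤ ⌊13·(N.wlen + 3000)/16⌋`.**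
[cite: Grigorchuk1984, length-reduction lemma] [cite: Bartholdi1998, Prop. (η-contraction at level one)] -/
theorem exists_sec_nforms (N : NForm) (hN : N.eval ∈ stabOne) :
    ∃ N₀ N₁ : NForm, N₀.eval = sec false ⟨N.eval, hN⟩ ∧ N₁.eval = sec true ⟨N.eval, hN⟩ ∧ 16 * (N₀.wlen + N₁.wlen) ≤ 13 * (N.wlen + 3000) := by
  obtain ⟨w₀, w₁, h0, h1, hw⟩ := exists_secWords N hN
  refine ⟨nf w₀, nf w₁, by rw [eval_nf, h0], by rw [eval_nf, h1], ?_⟩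
  have := wlen_nf_le w₀
  have := wlen_nf_le w₁
  omega

end Grigorchuk

end Summit.CriticalPhenomena.PercolationContinuityZ3.Theorems.Transplant

end
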